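import Summits.QuantumFields.YangMills.Theses.OnsetCalibration
import Summits.QuantumFields.YangMills.Theorems.LangevinControlUVOSLegsFromFemtoAndGapStubCollar6

/-!
# Crux K2 `SubOnsetCeilings` (stmt-QuantumFields-23313) — line `dlr-collar-subonset` (lead-written skeleton)

Route `OnsetCalibration`; the crux is `Summit.QuantumFields.YangMills.Theses.OnsetCalibration.SubOnsetCeilings`:
the plane-resolved centred-moment ceilings `(C/R⁴)ⁿ` of `MomentBounds6`, but at every SELF-LOCATED sub-onset
resolution `s` (no non-triviality floor on `[2s, 1]`) instead of at a unit map `a(β)` of record, for collars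
`R·s ≤ ℓ₄`, all odd tori `(ℤ/(2L+1))⁴`, all `n`.

## The line (one analytic stub + a kernel-checked transfer)

* `stub_centredBoundaryLaw6` — the **sub-onset frozen-boundary law on centred cubes** (plane-resolved,
  oscillation form; reshape r1 of `stub_subOnsetBoundaryLaw6`, weakest form the transfer consumes): for every
  SU(2)-class datum there is `ε₀` such that for every live floor level `ε ≤ ε₀` there are `C₁, ℓ₁, β₁` with: for
  `β ≥ β₁`, every sub-onset resolution `s ∈ (0,1]`, every orientation `q`, site `x` and radius `R ≥ 1` with the
  CENTRED cube of side `2R+3` around `x` femto IN THE UNIT `s` (`(2R+3)·s ≤ ℓ₁`), the kernel means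
  `kerE G r β (x − (R+1)) (2R+3) η (plane G r q x)` over ALL exteriors `η` lie in an interval of half-width
  `C₁/R⁴` (the centre `m` may depend on everything but `η`).  This is the tree's `FBL6` (route LangevinControlUV,
  line dlr-collar-transfer) with the unit of record replaced by the self-located resolution, restricted to the
  cubes the transfer actually uses (general cubes follow by DLR consistency but are not needed).  Size: XL / open
  (= the E0′/N32 ceiling content of the ladder; Bałaban's large-field problem at the observable level, uniform in
  the Dirichlet data).
* `SubOnsetCeilings_of_boundaryLaw` — PROVED here: the DLR collar transfer, one torus-DLR step per site on the
  radius-`R+1` cubes around the insertion sites (tree `abs_integral_prod_sub_mean_le`, Georgii Thm 4.17), exactly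
  as in the landed `DlrCollarTransfer.stub_collar6`, run at resolution `s`: constants `C = 2C₁`, `ℓ₄ = ℓ₁/5`,
  `β₄ = β₁`; the femto condition `(2R+3)·s ≤ 5R·s ≤ ℓ₁` is where `R·s ≤ ℓ₄` is used.
* `SubOnsetCeilings_of_stubs` concludes the crux BY NAME from the stub.

Why this line and not «pair ceiling + tree-graph domination» (the planner's two-layer plan): a Gaussian-type
domination of the centred `n`-fold moment by pair strengths carries `(n−1)!!`-type combinatorial factors, which the
literal `(C/R⁴)ⁿ` (one `C` for all `n`) does not tolerate; the DLR collar gives `(2ε)ⁿ` with no combinatorics and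
is already kernel-checked in the tree.  What the line cannot weaken: the boundary law must hold for EVERY exterior
(a «typical exterior» version pays an additive `P(bad boundary)` per cube, and near the onset a single non-cold
plaquette has probability `≥ e^{-2β}` while `R⁻⁴ ≍ (a(β)/ℓ₄)⁴ ≍ e^{-(12π²/11)β}` for SU(2) — lattice-scale large
fields are NOT rarer than the ceiling, so rarity cannot replace uniformity; this is Bałaban's large-field wall,
met in self-located units).

HONEST LABEL: nothing here proves the crux; the leaf of the route (rung R2a-IV) is summit-bearing but conditional
on K1 `OnsetFloors` (NT residual) and on this K2.  No mass gap, no summit.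
-/

set_option autoImplicit false

noncomputable section

open scoped SchwartzMap
open MeasureTheory Filter Topology
open Literature.MathematicalPhysics.QuantumFieldTheory Literature.MathematicalPhysics.QuantumLattice
open Literature.MathematicalPhysics.AQFT Literature.Probability.LatticeModels
open Summit.QuantumFields.YangMills.Cruxes.OSLegsFromFemtoAndGap.DlrCollarTransfer

namespace Summit.QuantumFields.YangMills.Cruxes.SubOnsetCeilings.DlrCollarSubonset

/-- **Stub `stub_centredBoundaryLaw6` — the sub-onset plane-resolved frozen-boundary law on centred cubes
(oscillation form; reshape r1, replaces `stub_subOnsetBoundaryLaw6`).**  For every SU(2)-class `G`, lattice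
representation `r` and floor datum `(v, f, g, h, Λ₅)` there is `ε₀ > 0` such that for every live floor level
`0 < ε ≤ ε₀` there are `C₁ ≥ 0`, `ℓ₁ > 0`, `β₁` with: for all `β ≥ β₁`, every resolution `s ∈ (0, 1]` with NO floor
on `[2s, 1]`, every orientation `q = (i < j)`, site `x` and radius `R ≥ 1` with `(2R+3)·s ≤ ℓ₁`, there is a centre
`m` with `|kerE G r β (x − (R+1)) (2R+3) η (plane G r q x) − m| ≤ C₁ / R⁴` for EVERY exterior `η` (the kernel of
the cube of side `2R+3` centred at `x`, where `x` has depth `R+2`).  The hardest and only analytic stub. -/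
theorem stub_centredBoundaryLaw6 :
    ∀ (G : Type) [Group G] [TopologicalSpace G] [IsTopologicalGroup G] [CompactSpace G],
      IsCompactSimpleLieGroup G → Nonempty (G ≃ₜ* Matrix.specialUnitaryGroup (Fin 2) ℂ) →
      letI : MeasurableSpace G := borel G
      haveI : BorelSpace G := ⟨rfl⟩
      ∀ (r : LatticeRep G) (v f g h : 𝓢(EuclideanSpace ℝ (Fin 4), ℝ)) (Λ₅ : ℝ),
        ∃ ε₀ : ℝ, 0 < ε₀ ∧ ∀ ε : ℝ, 0 < ε → ε ≤ ε₀ →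
          (∃ β₅ : ℝ, ∀ β : ℝ, β₅ ≤ β → ∃ s : ℝ, 0 < s ∧ s ≤ 1 ∧
            (∀ L : ℕ, Λ₅ ≤ s * L → ε ≤ Q2 G r β L s (thetaTest 4 v) v) ∧
            (∀ L : ℕ, Λ₅ ≤ s * L → ε ≤ |Q3 G r β L s f g h|)) →
          ∃ (C₁ ℓ₁ β₁ : ℝ), 0 < ℓ₁ ∧ 0 ≤ C₁ ∧ ∀ β : ℝ, β₁ ≤ β → ∀ s : ℝ, 0 < s → s ≤ 1 →
            (∀ s' : ℝ, 2 * s ≤ s' → s' ≤ 1 →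
              ¬ ((∀ L : ℕ, Λ₅ ≤ s' * L → ε ≤ Q2 G r β L s' (thetaTest 4 v) v) ∧
                 (∀ L : ℕ, Λ₅ ≤ s' * L → ε ≤ |Q3 G r β L s' f g h|))) →
            ∀ (q : Fin 4 × Fin 4) (x : Fin 4 → ℤ) (R : ℕ), q.1 < q.2 → 1 ≤ R →
              ((2 * R + 3 : ℕ) : ℝ) * s ≤ ℓ₁ →
                ∃ m : ℝ, ∀ η : LGConfig 4 G,
                  |kerE G r β (fun k => x k - (R + 1)) (2 * R + 3) η (plane G r q x) - m| ≤ C₁ / (R : ℝ) ^ 4 := by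
  sorry

/-- **One-resolution collar transfer in oscillation form (proved).**  At a fixed coupling `β` and resolution
`s > 0`: if on every centred cube of side `2R'+3` (`R' ≥ 1`, `(2R'+3)·s ≤ ℓ₁`) the kernel means of each
single-plane field at the centre oscillate over the exteriors by at most `C₁/R'⁴` around some centre, then on
every odd torus the centred mixed moments of single-plane fields at `n` sites with pairwise torus separation
`≥ 2R+4` (`1 ≤ R`, `R·s ≤ ℓ₁/5`, `4R+8 ≤ L`) are at most `(2C₁/R⁴)ⁿ`.  One torus-DLR step per site on the radius-`R+1` cube around it (tree
`abs_integral_prod_sub_mean_le`, Georgii Thm. 4.17), observables shifted by their centres so that the common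
reference value is `0`; cube/injectivity/separation geometry and the uniform bound on single-plane fields from
the landed `DlrCollarTransfer.stub_collar6` file.  The femto condition `(2R+3)·s ≤ 5R·s ≤ ℓ₁` is where
`R·s ≤ ℓ₁/5` is used. -/
theorem momentCeilings_of_boundaryOscillation {G : Type} [Group G] [TopologicalSpace G] [IsTopologicalGroup G]
    [CompactSpace G] [MeasurableSpace G] [BorelSpace G] (r : LatticeRep G) {β C₁ ℓ₁ s : ℝ} (hs0 : 0 < s)
    (hF : ∀ (q : Fin 4 × Fin 4) (x : Fin 4 → ℤ) (R : ℕ), q.1 < q.2 → 1 ≤ R → ((2 * R + 3 : ℕ) : ℝ) * s ≤ ℓ₁ →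
      ∃ m : ℝ, ∀ η : LGConfig 4 G,
        |kerE G r β (fun k => x k - (R + 1)) (2 * R + 3) η (plane G r q x) - m| ≤ C₁ / (R : ℝ) ^ 4)
    (L n : ℕ) (q : Fin n → Fin 4 × Fin 4) (x : Fin n → (Fin 4 → ℤ)) (R : ℕ) (hq : ∀ i, (q i).1 < (q i).2)
    (hR : 1 ≤ R) (hRs : (R : ℝ) * s ≤ ℓ₁ / 5) (hRL : 4 * R + 8 ≤ L)
    (hsep : ∀ i j : Fin n, i ≠ j → ∃ k : Fin 4,
      (2 * (R : ℤ) + 4) ≤ |((((x i k - x j k : ℤ) : ZMod (2 * L + 1))).valMinAbs : ℤ)|) :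
    |torusE G r β L (fun U => ∏ i, (plane G r (q i) (x i) U - torusE G r β L (plane G r (q i) (x i))))| ≤
      (2 * C₁ / (R : ℝ) ^ 4) ^ n := by
  haveI : SecondCountableTopology G :=
    (r.continuous.isClosedEmbedding r.injective).isEmbedding.secondCountableTopology
  haveI := isProbabilityMeasure_wilsonMeasure (d := 4) (L := 2 * L + 1) r.ρ r.continuous β
  obtain ⟨CA, hCA⟩ := exists_abs_plane_le r
  -- the cubes of side `2R+3` around the sites are femto in the unit `s`
  have hb : ((2 * R + 3 : ℕ) : ℝ) * s ≤ ℓ₁ := by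
    have h5 : ((2 * R + 3 : ℕ) : ℝ) ≤ 5 * R := by
      have : (1 : ℝ) ≤ R := by exact_mod_cast hR
      push_cast
      linarith
    calc ((2 * R + 3 : ℕ) : ℝ) * s ≤ 5 * R * s := mul_le_mul_of_nonneg_right h5 hs0.le
      _ = 5 * ((R : ℝ) * s) := by ring
      _ ≤ 5 * (ℓ₁ / 5) := by gcongr
      _ = ℓ₁ := by ring
  -- the centres of the kernel means at the cube centres, one per site
  choose m hm using fun i : Fin n => hF (q i) (x i) R (hq i) hR hb
  -- the data of the abstract collar bound: volumes = supports = the cubes, observables shifted by their centres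
  have hmeas : ∀ i : Fin n, Measurable (plane G r (q i) (x i)) := fun i =>
    (continuous_plane r (q i) (x i)).measurable
  have hAc : ∀ i : Fin n, Continuous fun U => plane G r (q i) (x i) U - m i := fun i =>
    (continuous_plane r (q i) (x i)).sub continuous_const
  have hAb : ∀ (i : Fin n) (U : LGConfig 4 G), |plane G r (q i) (x i) U - m i| ≤ CA + ∑ j, |m j| :=
    fun i U => (abs_sub _ _).trans (add_le_add (hCA _ _ _)
      (Finset.single_le_sum (f := fun j => |m j|) (fun j _ => abs_nonneg _) (Finset.mem_univ i)))
  have hAS : ∀ i : Fin n, IsCylinder (fun U => plane G r (q i) (x i) U - m i)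
      (OSLegsFromFemtoAndGap.DlrCollarTransfer.cubeEdges (fun k => x i k - (R + 1)) (2 * R + 3)) :=
    fun i U V hUV => by simp only [isCylinder_plane_cube r hR (q i) (x i) hUV]
  have hinj : ∀ i : Fin n, Set.InjOn (Torus.proj (2 * L + 1))
      (((OSLegsFromFemtoAndGap.DlrCollarTransfer.cubeEdges (fun k => x i k - (R + 1)) (2 * R + 3) ∪
          OSLegsFromFemtoAndGap.DlrCollarTransfer.cubeEdges (fun k => x i k - (R + 1)) (2 * R + 3) ∪
          (plaquettesTouching (OSLegsFromFemtoAndGap.DlrCollarTransfer.cubeEdges (fun k => x i k - (R + 1))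
            (2 * R + 3))).biUnion plaquetteEdges).image Prod.fst : Set (Fin 4 → ℤ))) :=
    fun i => injOn_torusProj_cube hRL (x i)
  have hfar : ∀ i j : Fin n, i ≠ j →
      ∀ e ∈ OSLegsFromFemtoAndGap.DlrCollarTransfer.cubeEdges (fun k => x j k - (R + 1)) (2 * R + 3) ∪
        (plaquettesTouching (OSLegsFromFemtoAndGap.DlrCollarTransfer.cubeEdges (fun k => x j k - (R + 1))
          (2 * R + 3))).biUnion plaquetteEdges,
      ∀ e' ∈ OSLegsFromFemtoAndGap.DlrCollarTransfer.cubeEdges (fun k => x i k - (R + 1)) (2 * R + 3),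
      torusEdge (2 * L + 1) e ≠ torusEdge (2 * L + 1) e' :=
    fun i j hij e he e' he' => torusEdge_ne_cube (hsep i j hij) he he'
  have hmean : ∀ i : Fin n, torusE G r β L (plane G r (q i) (x i)) - m i =
      ∫ W, (plane G r (q i) (x i) (torusLift (2 * L + 1) W) - m i)
        ∂(wilsonMeasure (d := 4) (L := 2 * L + 1) r.ρ β) := fun i =>
    (integral_sub_const_of_abs_le (μ := wilsonMeasure (d := 4) (L := 2 * L + 1) r.ρ β)
      ((continuous_plane r (q i) (x i)).comp (continuous_torusLift (2 * L + 1))).measurable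
      (fun W => hCA (q i) (x i) (torusLift (2 * L + 1) W)) (m i)).symm
  have hker : ∀ (i : Fin n) (η : LGConfig 4 G),
      |(∫ U, (plane G r (q i) (x i) U - m i) ∂(ymSpecification r.ρ β
        (OSLegsFromFemtoAndGap.DlrCollarTransfer.cubeEdges (fun k => x i k - (R + 1)) (2 * R + 3)) η)) - 0| ≤
        C₁ / (R : ℝ) ^ 4 := fun i η => by
    haveI := isProbabilityMeasure_ymSpecification r.ρ r.continuous β
      (OSLegsFromFemtoAndGap.DlrCollarTransfer.cubeEdges (fun k => x i k - (R + 1)) (2 * R + 3)) η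
    rw [sub_zero, integral_sub_const_of_abs_le (hmeas i) (fun U => hCA (q i) (x i) U) (m i)]
    exact hm i η
  have key : |∫ V, ∏ i, (plane G r (q i) (x i) (torusLift (2 * L + 1) V) - m i -
      (torusE G r β L (plane G r (q i) (x i)) - m i)) ∂(wilsonMeasure (d := 4) (L := 2 * L + 1) r.ρ β)| ≤
      (2 * (C₁ / (R : ℝ) ^ 4)) ^ n :=
    abs_integral_prod_sub_mean_le (d := 4) r.ρ r.continuous β (L := 2 * L + 1) (n := n)
      (fun i => OSLegsFromFemtoAndGap.DlrCollarTransfer.cubeEdges (fun k => x i k - (R + 1)) (2 * R + 3))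
      (fun i => OSLegsFromFemtoAndGap.DlrCollarTransfer.cubeEdges (fun k => x i k - (R + 1)) (2 * R + 3))
      (fun i U => plane G r (q i) (x i) U - m i) hAc hAb hAS hinj hfar
      (fun i => torusE G r β L (plane G r (q i) (x i)) - m i) hmean hker
  simp only [sub_sub_sub_cancel_right] at key
  rw [show (2 : ℝ) * C₁ / (R : ℝ) ^ 4 = 2 * (C₁ / (R : ℝ) ^ 4) from mul_div_assoc _ _ _]
  exact key

/-- **The crux from the stub** (`SubOnsetCeilings_of_stubs` concludes
`Summit.QuantumFields.YangMills.Theses.OnsetCalibration.SubOnsetCeilings` BY NAME): unpack the registered stub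
`stub_centredBoundaryLaw6` and feed each `(β, s)` with `s` sub-onset to the proved one-resolution transfer
`momentCeilings_of_boundaryOscillation`; constants `C = 2C₁`, `ℓ₄ = ℓ₁/5`, `β₄ = β₁`. -/
theorem SubOnsetCeilings_of_stubs : Summit.QuantumFields.YangMills.Theses.OnsetCalibration.SubOnsetCeilings := by
  unfold Summit.QuantumFields.YangMills.Theses.OnsetCalibration.SubOnsetCeilings
  intro G _ _ _ _ hG hcl
  letI : MeasurableSpace G := borel G
  haveI : BorelSpace G := ⟨rfl⟩
  intro r v f g h Λ₅
  obtain ⟨ε₀, hε₀, hBL'⟩ := stub_centredBoundaryLaw6 G hG hcl r v f g h Λ₅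
  refine ⟨ε₀, hε₀, fun ε hε hεle hlive => ?_⟩
  obtain ⟨C₁, ℓ₁, β₁, hℓ₁, hC₁, hF⟩ := hBL' ε hε hεle hlive
  refine ⟨2 * C₁, ℓ₁ / 5, β₁, by positivity, by positivity, ?_⟩
  intro β hβ s hs0 hs1 hsub L n q x R hq hR hRs hRL hsep
  exact momentCeilings_of_boundaryOscillation r hs0 (hF β hβ s hs0 hs1 hsub) L n q x R hq hR hRs hRL hsep

end Summit.QuantumFields.YangMills.Cruxes.SubOnsetCeilings.DlrCollarSubonset

end
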